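import Mathlib.Algebra.Homology.ShortComplex.ModuleCat
import Mathlib.Algebra.Homology.Embedding.CochainComplex
import Mathlib.Algebra.Homology.QuasiIso
import HarnessLib

/-!
# `H⁰ = Ker d⁰` and quasi-isomorphisms of complexes of modules concentrated in degrees `≥ 0`

For a cochain complex of modules `P` with `Pⁿ = 0` for `n < 0`, `H⁰(P) = Ker(d⁰ : P⁰ → P¹)`; hence a
quasi-isomorphism `ψ : P → C` between two such complexes identifies `Ker d⁰_P ≅ Ker d⁰_C`
(`nonempty_linearEquiv_ker_of_quasiIso`). This is the last step in reading off
`H⁰(X_s, 𝓕_s) = Ker(d⁰ ⊗ κ(s))` from the Grothendieck complex (Görtz–Wedhorn II, proof of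
Prop. 23.117, p. 466: "`H⁰ = Ker(d⁰ ⊗ κ(s))`" for a complex starting in degree `0`; this tree:
`Literature/AlgebraicGeometry/Motives/GrothendieckComplexH0Projective`). Everything is assembled
from Mathlib (`HomologicalComplex.isIso_homologyπ` when the incoming differential vanishes,
`homologyπ_naturality`, `ShortComplex.moduleCatCyclesIso`); only existence of the isomorphism is
recorded (as a `Nonempty`), which is all that rank/dimension statements need.

## References

* U. Görtz, T. Wedhorn, *Algebraic Geometry II: Cohomology of Schemes*, Springer Spektrum (2023),
  doi:10.1007/978-3-658-43031-3, proof of Prop. 23.117, p. 466. [GortzWedhorn2023]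
-/

universe v u

open CategoryTheory CategoryTheory.Limits HomologicalComplex

namespace Literature.Algebra.Homology

variable {S : Type u} [Ring S]

/-- The kernels of `d : Kⁱ → Kʲ` and `d : Kⁱ → Kʲ'` agree for `j = j'` (transport). [folklore] -/
def kerDEquivOfEq (K : CochainComplex (ModuleCat.{v} S) ℤ) (i : ℤ) {j j' : ℤ} (e : j = j') :
    LinearMap.ker (K.d i j).hom ≃ₗ[S] LinearMap.ker (K.d i j').hom := by
  subst e
  exact LinearEquiv.refl _ _

/-- **The cycles in degree `0` are `Ker(d : K⁰ → K¹)`** for a complex of modules (Mathlib's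
`K.cycles 0`, a kernel object, made concrete by `ShortComplex.moduleCatCyclesIso`). [folklore] -/
noncomputable def cyclesZeroEquivKer (K : CochainComplex (ModuleCat.{v} S) ℤ) :
    K.cycles 0 ≃ₗ[S] LinearMap.ker (K.d 0 1).hom :=
  (K.sc 0).moduleCatCyclesIso.toLinearEquiv.trans
    (kerDEquivOfEq K 0 (CochainComplex.next ℤ 0))

/-- **A quasi-isomorphism of complexes of modules concentrated in degrees `≥ 0` identifies the
kernels of the first differentials**: `Ker(d⁰_P) ≅ H⁰(P) ≅ H⁰(C) ≅ Ker(d⁰_C)`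
(`H⁰ = Ker d⁰` as `P^{-1} = C^{-1} = 0`; Görtz–Wedhorn II, p. 466). [folklore] -/
theorem nonempty_linearEquiv_ker_of_quasiIso {P C : CochainComplex (ModuleCat.{v} S) ℤ}
    (ψ : P ⟶ C) [QuasiIso ψ] [P.IsStrictlyGE 0] [C.IsStrictlyGE 0] :
    Nonempty (LinearMap.ker (P.d 0 1).hom ≃ₗ[S] LinearMap.ker (C.d 0 1).hom) := by
  have hP0 : P.d (-1) 0 = 0 := (P.isZero_of_isStrictlyGE 0 (-1) (by omega)).eq_of_src _ _
  have hC0 : C.d (-1) 0 = 0 := (C.isZero_of_isStrictlyGE 0 (-1) (by omega)).eq_of_src _ _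
  haveI := P.isIso_homologyπ (-1) 0 (by simp) hP0
  haveI := C.isIso_homologyπ (-1) 0 (by simp) hC0
  haveI : IsIso (homologyMap ψ 0) := by
    rw [← quasiIsoAt_iff_isIso_homologyMap]
    infer_instance
  have hc : IsIso (cyclesMap ψ 0) := by
    have e : cyclesMap ψ 0 = P.homologyπ 0 ≫ homologyMap ψ 0 ≫ inv (C.homologyπ 0) := by
      rw [← Category.assoc, homologyπ_naturality, Category.assoc, IsIso.hom_inv_id,
        Category.comp_id]
    rw [e]
    infer_instance
  exact ⟨(cyclesZeroEquivKer P).symm.trans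
    ((asIso (cyclesMap ψ 0)).toLinearEquiv.trans (cyclesZeroEquivKer C))⟩

end Literature.Algebra.Homology
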